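import Mathlib
import HarnessLib

/-!
# Cell pnp-psdrank, route `ChebyshevTracialDesign`: real-arithmetic tools for the RELATIVE form of the centred second moment's
# level-smoothness sum — the orders `k ≥ 2` (crux `TracialDecayExp20`, stmt-PneNP-19878)

Brick 139a (prover g28; MEMO-30 rev 3 §3b/§4). Brick 138 (`…GammaDirectionSecondMomentBudget.sum_abs_fwdDiff_centredSecond_le_of_budgets`)
bounds `Σ_{k=1}^{D} c_k|Δ^k A^m(0)|` (`A^m_c(x) = E_c[1_{X=x}(n_A − m)²]`) at a perfect matching by `½·FIRST + Σ_{k∈[2,D]} SECOND_k`, with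
`SECOND_k` explicit in per-order budgets `R₀, R₁, R₂` of the three law families `G₀ = law_{[n]}(2r+7,·;x)`, `G₁ = Σ_v law_{[n]∖e_v}(2r+5,·;x−2)`,
`G₂ = Σ_{v≠w} law_{[n]∖e_v∖e_w}(2r+3,·;x−4)` of the Leibniz split. Hypothesis (hA) of brick 130 wants `≤ ε_A·A^m_1(x)`. This file is the pure
real arithmetic of the `k ≥ 2` part of that passage (no shells):

* §1 **`sum_Ico_two_budget_le`**: if the budgets have the Lq SHAPE `R_r(i) ≤ Γ·q^i·g_r + κ_r·(4/3)^i·τ` (`0 ≤ q ≤ 1`; `g_r = G_r(0)` the level-`1`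
  values, `κ = (1, κ₁, κ₂)`, `τ` a common Chernoff tail; the tree's `abs_fwdDiff_iter_shellLaw_le_of_hyps` and brick 136 deliver exactly this
  shape), then `Σ_{k∈[2,D]} SECOND_k ≤ D·Mb` with `Mb` explicit and carrying the powers `q², q, 1` of the three node groups (`k`, `k−1`, `k−2`)
  — crude in `k` (`4k ≤ 4D`, `8C(k,2) ≤ 8D²`) but sharp in `q` (the `k−2` group is the inherent `DRIFT2 = 2(Δ_c mean)²·law` term).
* §2 **`second_le_of_shapes`**: `D·Mb ≤ λ₂·law + μ₂·τ` once `g₀ = law`, `g₁ ≤ (n/(2r+6))·a·law`, `g₂ ≤ (n(n−2)/((2r+6)(2r+4)))·a²·law`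
  (the level-`1` identities `F¹ = (T/n)G₁(0)`, `F² = (T(T−2)/K)G₂(0)` of the three-law form with `F¹ ≤ a·law`, `F² ≤ a²·law`), `κ₁ = a`,
  `κ₂ = a²`, `0 ≤ m ≤ a`; `λ₂, μ₂` explicit in `D, a, r, n, Γ, q`.
The `k = 1` half and the floors are `…SecondMomentRelativeFirst`; the shell instance (brick 139) is `…SecondMomentRelative`.
WHAT THIS FILE DOES NOT DO: anything about shells, the budgets themselves (Lq / brick 136), (V), the numerics `ε_A → 0`, `TracialDecayExp20`
itself, psd rank of P_PM(K_n), or P vs NP. [cite: RollinRoss2010, §4.1 Thm 4.2] [cite: Boole2009, Ch. II Art. 10 Ex. 3 eq. (8)]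
Stature: support/instrument (kernel lane, no defs, axioms standard; pure bookkeeping). Supports stmt-PneNP-19878.
-/

set_option linter.dupNamespace false -- `Summit.PneNP.PneNP.…`: summit = sub-problem (D-0017)

noncomputable section

namespace Summit.PneNP.PneNP.Theorems.ChebyshevTracialDesignGammaDirectionSecondMomentRelativeOrders

open Finset

/-! ### §1 The orders `k ≥ 2`: budgets of Lq shape, summed crudely in `k` and sharply in `q` -/

/-- **Monotonicity of an Lq-shaped budget**: for `0 ≤ q ≤ 1`, `Γ, g, κ, τ ≥ 0`, `e ≤ j ≤ D`:
`Γq^j g + κ(4/3)^j τ ≤ Γq^e g + κ(4/3)^D τ`. [cite: RollinRoss2010, §4.1 Thm 4.2] -/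
theorem lqShape_mono {Γ q g κ τ : ℝ} (hΓ : 0 ≤ Γ) (hq0 : 0 ≤ q) (hq1 : q ≤ 1) (hg : 0 ≤ g) (hκ : 0 ≤ κ) (hτ : 0 ≤ τ)
    {e j D : ℕ} (hej : e ≤ j) (hjD : j ≤ D) :
    Γ * q ^ j * g + κ * ((4 / 3 : ℝ) ^ j * τ) ≤ Γ * q ^ e * g + κ * ((4 / 3 : ℝ) ^ D * τ) := by
  have h1 : q ^ j ≤ q ^ e := pow_le_pow_of_le_one hq0 hq1 hej
  have h2 : (4 / 3 : ℝ) ^ j ≤ (4 / 3 : ℝ) ^ D := pow_le_pow_right₀ (by norm_num) hjD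
  have h3 : Γ * q ^ j * g ≤ Γ * q ^ e * g :=
    mul_le_mul_of_nonneg_right (mul_le_mul_of_nonneg_left h1 hΓ) hg
  have h4 : κ * ((4 / 3 : ℝ) ^ j * τ) ≤ κ * ((4 / 3 : ℝ) ^ D * τ) :=
    mul_le_mul_of_nonneg_left (mul_le_mul_of_nonneg_right h2 hτ) hκ
  linarith

/-- **The `k ≥ 2` budget sum of brick 138 under Lq-shaped budgets.** With `0 ≤ q ≤ 1`, `Γ, τ, g_r, κ_r ≥ 0`, `0 < K`, `0 < ν`, `2 ≤ T`
and `R_r(i) ≤ Γq^i g_r + κ_r(4/3)^i τ` for `i ≤ D` (`κ₀ = 1`):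
`Σ_{k∈[2,D]} [ |1|·(T(T−2)/K·R₂(k) + 4k(T−2)/K·(R₂(k−1)+R₂(k)) + 8C(k,2)/K·(R₂(k−2)+2R₂(k−1)+R₂(k))) + |1−2m|(T/ν·R₁(k) + 2k/ν·(R₁(k−1)+R₁(k))) + |m²|R₀(k) ]`
`≤ D·[ T(T−2)/K·(Γq²g₂+κ₂Wτ) + 4D(T−2)/K·2(Γq g₂+κ₂Wτ) + 8D²/K·4(Γg₂+κ₂Wτ) + |1−2m|(T/ν(Γq²g₁+κ₁Wτ) + 2D/ν·2(Γq g₁+κ₁Wτ)) + m²(Γq²g₀+Wτ) ]`,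
`W = (4/3)^D`. [cite: Boole2009, Ch. II Art. 10 Ex. 3 eq. (8)] [cite: RollinRoss2010, §4.1 Thm 4.2] -/
theorem sum_Ico_two_budget_le (D : ℕ) (T K ν m Γ q τ g₀ g₁ g₂ κ₁ κ₂ : ℝ) (R₀ R₁ R₂ : ℕ → ℝ)
    (hq0 : 0 ≤ q) (hq1 : q ≤ 1) (hΓ : 0 ≤ Γ) (hτ : 0 ≤ τ) (hg₀ : 0 ≤ g₀) (hg₁ : 0 ≤ g₁) (hg₂ : 0 ≤ g₂)
    (hκ₁ : 0 ≤ κ₁) (hκ₂ : 0 ≤ κ₂) (hK : 0 < K) (hν : 0 < ν) (hT : 2 ≤ T)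
    (hR₀ : ∀ i, i ≤ D → R₀ i ≤ Γ * q ^ i * g₀ + 1 * ((4 / 3 : ℝ) ^ i * τ))
    (hR₁ : ∀ i, i ≤ D → R₁ i ≤ Γ * q ^ i * g₁ + κ₁ * ((4 / 3 : ℝ) ^ i * τ))
    (hR₂ : ∀ i, i ≤ D → R₂ i ≤ Γ * q ^ i * g₂ + κ₂ * ((4 / 3 : ℝ) ^ i * τ)) :
    ∑ k ∈ Ico 2 (D + 1), (|(1 : ℝ)| * (T * (T - 2) / K * R₂ k +
            4 * (k : ℝ) * (T - 2) / K * (R₂ (k - 1) + R₂ k) +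
            8 * ((k.choose 2 : ℕ) : ℝ) / K * (R₂ (k - 2) + 2 * R₂ (k - 1) + R₂ k)) +
          |1 - 2 * m| * (T / ν * R₁ k + 2 * (k : ℝ) / ν * (R₁ (k - 1) + R₁ k)) +
          |m ^ 2| * R₀ k) ≤
      (D : ℝ) * (T * (T - 2) / K * (Γ * q ^ 2 * g₂ + κ₂ * ((4 / 3 : ℝ) ^ D * τ)) +
          4 * (D : ℝ) * (T - 2) / K * (2 * (Γ * q ^ 1 * g₂ + κ₂ * ((4 / 3 : ℝ) ^ D * τ))) +
          8 * (D : ℝ) ^ 2 / K * (4 * (Γ * q ^ 0 * g₂ + κ₂ * ((4 / 3 : ℝ) ^ D * τ))) +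
        |1 - 2 * m| * (T / ν * (Γ * q ^ 2 * g₁ + κ₁ * ((4 / 3 : ℝ) ^ D * τ)) +
          2 * (D : ℝ) / ν * (2 * (Γ * q ^ 1 * g₁ + κ₁ * ((4 / 3 : ℝ) ^ D * τ)))) +
        m ^ 2 * (Γ * q ^ 2 * g₀ + 1 * ((4 / 3 : ℝ) ^ D * τ))) := by
  -- abbreviations for the three node bounds of each family
  obtain ⟨X₂, hX₂⟩ : ∃ e : ℝ, e = Γ * q ^ 2 * g₂ + κ₂ * ((4 / 3 : ℝ) ^ D * τ) := ⟨_, rfl⟩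
  obtain ⟨X₁, hX₁⟩ : ∃ e : ℝ, e = Γ * q ^ 1 * g₂ + κ₂ * ((4 / 3 : ℝ) ^ D * τ) := ⟨_, rfl⟩
  obtain ⟨X₀, hX₀⟩ : ∃ e : ℝ, e = Γ * q ^ 0 * g₂ + κ₂ * ((4 / 3 : ℝ) ^ D * τ) := ⟨_, rfl⟩
  obtain ⟨Y₂, hY₂⟩ : ∃ e : ℝ, e = Γ * q ^ 2 * g₁ + κ₁ * ((4 / 3 : ℝ) ^ D * τ) := ⟨_, rfl⟩
  obtain ⟨Y₁, hY₁⟩ : ∃ e : ℝ, e = Γ * q ^ 1 * g₁ + κ₁ * ((4 / 3 : ℝ) ^ D * τ) := ⟨_, rfl⟩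
  obtain ⟨Z₂, hZ₂⟩ : ∃ e : ℝ, e = Γ * q ^ 2 * g₀ + 1 * ((4 / 3 : ℝ) ^ D * τ) := ⟨_, rfl⟩
  rw [← hX₂, ← hX₁, ← hX₀, ← hY₂, ← hY₁, ← hZ₂]
  have hW0 : 0 ≤ (4 / 3 : ℝ) ^ D * τ := by positivity
  have hX₀0 : 0 ≤ X₀ := by rw [hX₀]; positivity
  have hX₁0 : 0 ≤ X₁ := by rw [hX₁]; positivity
  have hY₁0 : 0 ≤ Y₁ := by rw [hY₁]; positivity
  have hq21 : q ^ 2 ≤ q ^ 1 := pow_le_pow_of_le_one hq0 hq1 (by norm_num)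
  have hq10 : q ^ 1 ≤ q ^ 0 := pow_le_pow_of_le_one hq0 hq1 (by norm_num)
  have hX21 : X₂ ≤ X₁ := by
    rw [hX₂, hX₁]
    have := mul_le_mul_of_nonneg_right (mul_le_mul_of_nonneg_left hq21 hΓ) hg₂
    linarith
  have hX10 : X₁ ≤ X₀ := by
    rw [hX₁, hX₀]
    have := mul_le_mul_of_nonneg_right (mul_le_mul_of_nonneg_left hq10 hΓ) hg₂
    linarith
  have hY21 : Y₂ ≤ Y₁ := by
    rw [hY₂, hY₁]
    have := mul_le_mul_of_nonneg_right (mul_le_mul_of_nonneg_left hq21 hΓ) hg₁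
    linarith
  have hT0 : 0 ≤ T - 2 := by linarith
  have hT0' : 0 ≤ T := by linarith
  have hX₂0 : 0 ≤ X₂ := by rw [hX₂]; positivity
  have hY₂0 : 0 ≤ Y₂ := by rw [hY₂]; positivity
  have hZ₂0 : 0 ≤ Z₂ := by rw [hZ₂]; positivity
  obtain ⟨Mb, hMb⟩ : ∃ e : ℝ, e = T * (T - 2) / K * X₂ + 4 * (D : ℝ) * (T - 2) / K * (2 * X₁) + 8 * (D : ℝ) ^ 2 / K * (4 * X₀) +
      |1 - 2 * m| * (T / ν * Y₂ + 2 * (D : ℝ) / ν * (2 * Y₁)) + m ^ 2 * Z₂ := ⟨_, rfl⟩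
  -- the termwise bound
  have hterm : ∀ k ∈ Ico 2 (D + 1), (|(1 : ℝ)| * (T * (T - 2) / K * R₂ k +
            4 * (k : ℝ) * (T - 2) / K * (R₂ (k - 1) + R₂ k) +
            8 * ((k.choose 2 : ℕ) : ℝ) / K * (R₂ (k - 2) + 2 * R₂ (k - 1) + R₂ k)) +
          |1 - 2 * m| * (T / ν * R₁ k + 2 * (k : ℝ) / ν * (R₁ (k - 1) + R₁ k)) +
          |m ^ 2| * R₀ k) ≤ Mb := by
    intro k hk
    rw [mem_Ico] at hk
    obtain ⟨hk2, hkD⟩ := hk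
    have hkD' : k ≤ D := by omega
    have hkR : (k : ℝ) ≤ D := by exact_mod_cast hkD'
    -- node bounds
    have b2k : R₂ k ≤ X₂ := by
      rw [hX₂]; exact (hR₂ k hkD').trans (lqShape_mono hΓ hq0 hq1 hg₂ hκ₂ hτ hk2 hkD')
    have b2k1 : R₂ (k - 1) ≤ X₁ := by
      rw [hX₁]; exact (hR₂ (k - 1) (by omega)).trans (lqShape_mono hΓ hq0 hq1 hg₂ hκ₂ hτ (by omega) (by omega))
    have b2k2 : R₂ (k - 2) ≤ X₀ := by
      rw [hX₀]; exact (hR₂ (k - 2) (by omega)).trans (lqShape_mono hΓ hq0 hq1 hg₂ hκ₂ hτ (by omega) (by omega))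
    have b1k : R₁ k ≤ Y₂ := by
      rw [hY₂]; exact (hR₁ k hkD').trans (lqShape_mono hΓ hq0 hq1 hg₁ hκ₁ hτ hk2 hkD')
    have b1k1 : R₁ (k - 1) ≤ Y₁ := by
      rw [hY₁]; exact (hR₁ (k - 1) (by omega)).trans (lqShape_mono hΓ hq0 hq1 hg₁ hκ₁ hτ (by omega) (by omega))
    have b0k : R₀ k ≤ Z₂ := by
      rw [hZ₂]
      exact (hR₀ k hkD').trans (lqShape_mono hΓ hq0 hq1 hg₀ zero_le_one hτ hk2 hkD')
    -- the choose coefficient: `C(k,2) ≤ D²`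
    have hch : ((k.choose 2 : ℕ) : ℝ) ≤ (D : ℝ) ^ 2 := by
      have h1 : k.choose 2 ≤ D * D := by
        rw [Nat.choose_two_right]
        exact (Nat.div_le_self _ _).trans (Nat.mul_le_mul hkD' (by omega))
      have h2 : ((k.choose 2 : ℕ) : ℝ) ≤ ((D * D : ℕ) : ℝ) := by exact_mod_cast h1
      rw [Nat.cast_mul] at h2
      rw [sq]; exact h2
    -- the five pieces
    have p1 : T * (T - 2) / K * R₂ k ≤ T * (T - 2) / K * X₂ :=
      mul_le_mul_of_nonneg_left b2k (div_nonneg (mul_nonneg hT0' hT0) hK.le)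
    have p2 : 4 * (k : ℝ) * (T - 2) / K * (R₂ (k - 1) + R₂ k) ≤ 4 * (D : ℝ) * (T - 2) / K * (2 * X₁) := by
      have hs : R₂ (k - 1) + R₂ k ≤ 2 * X₁ := by linarith
      calc 4 * (k : ℝ) * (T - 2) / K * (R₂ (k - 1) + R₂ k) ≤ 4 * (k : ℝ) * (T - 2) / K * (2 * X₁) :=
            mul_le_mul_of_nonneg_left hs (div_nonneg (mul_nonneg (by positivity) hT0) hK.le)
        _ ≤ 4 * (D : ℝ) * (T - 2) / K * (2 * X₁) := by
            apply mul_le_mul_of_nonneg_right _ (by linarith)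
            apply div_le_div_of_nonneg_right _ hK.le
            exact mul_le_mul_of_nonneg_right (mul_le_mul_of_nonneg_left hkR (by norm_num)) hT0
    have p3 : 8 * ((k.choose 2 : ℕ) : ℝ) / K * (R₂ (k - 2) + 2 * R₂ (k - 1) + R₂ k) ≤ 8 * (D : ℝ) ^ 2 / K * (4 * X₀) := by
      have hs : R₂ (k - 2) + 2 * R₂ (k - 1) + R₂ k ≤ 4 * X₀ := by linarith
      calc 8 * ((k.choose 2 : ℕ) : ℝ) / K * (R₂ (k - 2) + 2 * R₂ (k - 1) + R₂ k)
          ≤ 8 * ((k.choose 2 : ℕ) : ℝ) / K * (4 * X₀) := mul_le_mul_of_nonneg_left hs (div_nonneg (by positivity) hK.le)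
        _ ≤ 8 * (D : ℝ) ^ 2 / K * (4 * X₀) := by
            apply mul_le_mul_of_nonneg_right _ (by linarith)
            apply div_le_div_of_nonneg_right _ hK.le
            exact mul_le_mul_of_nonneg_left hch (by norm_num)
    have p4 : |1 - 2 * m| * (T / ν * R₁ k + 2 * (k : ℝ) / ν * (R₁ (k - 1) + R₁ k)) ≤
        |1 - 2 * m| * (T / ν * Y₂ + 2 * (D : ℝ) / ν * (2 * Y₁)) := by
      apply mul_le_mul_of_nonneg_left _ (abs_nonneg _)
      have hs : R₁ (k - 1) + R₁ k ≤ 2 * Y₁ := by linarith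
      have q1 : T / ν * R₁ k ≤ T / ν * Y₂ := mul_le_mul_of_nonneg_left b1k (div_nonneg hT0' hν.le)
      have q2 : 2 * (k : ℝ) / ν * (R₁ (k - 1) + R₁ k) ≤ 2 * (D : ℝ) / ν * (2 * Y₁) := by
        calc 2 * (k : ℝ) / ν * (R₁ (k - 1) + R₁ k) ≤ 2 * (k : ℝ) / ν * (2 * Y₁) :=
              mul_le_mul_of_nonneg_left hs (div_nonneg (by positivity) hν.le)
          _ ≤ 2 * (D : ℝ) / ν * (2 * Y₁) := by
              apply mul_le_mul_of_nonneg_right _ (by linarith)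
              apply div_le_div_of_nonneg_right _ hν.le
              exact mul_le_mul_of_nonneg_left hkR (by norm_num)
      linarith
    have p5 : |m ^ 2| * R₀ k ≤ m ^ 2 * Z₂ := by
      rw [abs_of_nonneg (sq_nonneg m)]
      exact mul_le_mul_of_nonneg_left b0k (sq_nonneg m)
    rw [hMb, abs_one, one_mul]
    linarith
  have hMb0 : 0 ≤ Mb := by
    rw [hMb]
    have t1 : 0 ≤ T * (T - 2) / K * X₂ := mul_nonneg (div_nonneg (mul_nonneg hT0' hT0) hK.le) hX₂0
    have t2 : 0 ≤ 4 * (D : ℝ) * (T - 2) / K * (2 * X₁) :=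
      mul_nonneg (div_nonneg (mul_nonneg (by positivity) hT0) hK.le) (by linarith)
    have t3 : 0 ≤ 8 * (D : ℝ) ^ 2 / K * (4 * X₀) := by positivity
    have t4 : 0 ≤ |1 - 2 * m| * (T / ν * Y₂ + 2 * (D : ℝ) / ν * (2 * Y₁)) := by positivity
    have t5 : 0 ≤ m ^ 2 * Z₂ := by positivity
    linarith
  calc _ ≤ ∑ k ∈ Ico 2 (D + 1), Mb := sum_le_sum hterm
    _ = ((D + 1 - 2 : ℕ) : ℝ) * Mb := by rw [sum_const, Nat.card_Ico, nsmul_eq_mul]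
    _ ≤ (D : ℝ) * Mb := by
        apply mul_le_mul_of_nonneg_right _ hMb0
        exact_mod_cast (by omega : D + 1 - 2 ≤ D)
    _ = _ := by rw [hMb]

/-! ### §2 The `k ≥ 2` bound in two-term form -/

/-- **`D·Mb ≤ λ₂·law + μ₂·τ`** once the level-`1` values of the pinned families are compared with the law on `[n]`:
`g₀ = law`, `g₁ ≤ (ν/(2r+6))·a·law`, `g₂ ≤ (ν(ν−2)/((2r+6)(2r+4)))·a²·law` (`ν = n`, `T = 2r+6`, `K = ν(ν−2)`; the identities
`F¹ = (T/n)G₁(0)`, `F² = (T(T−2)/K)G₂(0)` of the three-law form and `F¹ ≤ a·law`, `F² ≤ a²·law`), `κ₁ = a`, `κ₂ = a²`, `0 ≤ m ≤ a`: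
`λ₂ = D·[2Γq²a² + 8DΓq a²/(2r+6) + 32D²Γa²/((2r+6)(2r+4)) + (2a+1)a(Γq² + 4DΓq/(2r+6))]`,
`μ₂ = D(4/3)^D·[a²((2r+6)(2r+4)/(ν(ν−2)) + 8D(2r+4)/(ν(ν−2)) + 32D²/(ν(ν−2)) + 1) + (2a+1)a(2r+6+4D)/ν]`.
[cite: RollinRoss2010, §4.1 Thm 4.2] [cite: Boole2009, Ch. II Art. 10 Ex. 3 eq. (8)] -/
theorem second_le_of_shapes (D r a : ℕ) (ν m Γ q τ law g₁ g₂ : ℝ)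
    (hq0 : 0 ≤ q) (hΓ : 0 ≤ Γ) (hτ : 0 ≤ τ) (hlaw : 0 ≤ law) (hν : 2 * (r : ℝ) + 10 ≤ ν)
    (hm0 : 0 ≤ m) (hma : m ≤ a)
    (hg₁ : g₁ ≤ ν / (2 * (r : ℝ) + 6) * ((a : ℝ) * law))
    (hg₂ : g₂ ≤ ν * (ν - 2) / ((2 * (r : ℝ) + 6) * (2 * (r : ℝ) + 4)) * ((a : ℝ) ^ 2 * law)) :
    (D : ℝ) * ((2 * (r : ℝ) + 6) * ((2 * (r : ℝ) + 6) - 2) / (ν * (ν - 2)) * (Γ * q ^ 2 * g₂ + (a : ℝ) ^ 2 * ((4 / 3 : ℝ) ^ D * τ)) +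
          4 * (D : ℝ) * ((2 * (r : ℝ) + 6) - 2) / (ν * (ν - 2)) * (2 * (Γ * q ^ 1 * g₂ + (a : ℝ) ^ 2 * ((4 / 3 : ℝ) ^ D * τ))) +
          8 * (D : ℝ) ^ 2 / (ν * (ν - 2)) * (4 * (Γ * q ^ 0 * g₂ + (a : ℝ) ^ 2 * ((4 / 3 : ℝ) ^ D * τ))) +
        |1 - 2 * m| * ((2 * (r : ℝ) + 6) / ν * (Γ * q ^ 2 * g₁ + (a : ℝ) * ((4 / 3 : ℝ) ^ D * τ)) +
          2 * (D : ℝ) / ν * (2 * (Γ * q ^ 1 * g₁ + (a : ℝ) * ((4 / 3 : ℝ) ^ D * τ)))) +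
        m ^ 2 * (Γ * q ^ 2 * law + 1 * ((4 / 3 : ℝ) ^ D * τ))) ≤
      (D : ℝ) * (2 * Γ * q ^ 2 * (a : ℝ) ^ 2 + 8 * (D : ℝ) * Γ * q * (a : ℝ) ^ 2 / (2 * (r : ℝ) + 6) +
            32 * (D : ℝ) ^ 2 * Γ * (a : ℝ) ^ 2 / ((2 * (r : ℝ) + 6) * (2 * (r : ℝ) + 4)) +
            (2 * (a : ℝ) + 1) * a * (Γ * q ^ 2 + 4 * (D : ℝ) * Γ * q / (2 * (r : ℝ) + 6))) * law +
        (D : ℝ) * (4 / 3 : ℝ) ^ D *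
            ((a : ℝ) ^ 2 * ((2 * (r : ℝ) + 6) * (2 * (r : ℝ) + 4) / (ν * (ν - 2)) + 8 * (D : ℝ) * (2 * (r : ℝ) + 4) / (ν * (ν - 2)) +
                32 * (D : ℝ) ^ 2 / (ν * (ν - 2)) + 1) +
              (2 * (a : ℝ) + 1) * a * ((2 * (r : ℝ) + 6 + 4 * D) / ν)) * τ := by
  have hr0 : (0 : ℝ) ≤ r := Nat.cast_nonneg r
  have ha0 : (0 : ℝ) ≤ a := Nat.cast_nonneg a
  have hD0 : (0 : ℝ) ≤ D := Nat.cast_nonneg D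
  have hν0 : 0 < ν := by linarith
  have hK0 : 0 < ν * (ν - 2) := mul_pos hν0 (by linarith)
  have hT0 : 0 < 2 * (r : ℝ) + 6 := by linarith
  have hT4 : 0 < 2 * (r : ℝ) + 4 := by linarith
  have hW0 : 0 ≤ (4 / 3 : ℝ) ^ D * τ := by positivity
  obtain ⟨W, hW⟩ : ∃ e : ℝ, e = (4 / 3 : ℝ) ^ D * τ := ⟨_, rfl⟩
  rw [← hW] at hW0 ⊢
  have habs1 : |1 - 2 * m| ≤ 2 * (a : ℝ) + 1 := by
    rw [abs_le]; constructor <;> linarith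
  have hm2 : m ^ 2 ≤ (a : ℝ) ^ 2 := by nlinarith
  have hg₁0' : Γ * q ^ 2 * g₁ ≤ Γ * q ^ 2 * (ν / (2 * (r : ℝ) + 6) * ((a : ℝ) * law)) :=
    mul_le_mul_of_nonneg_left hg₁ (by positivity)
  have hg₁1' : Γ * q ^ 1 * g₁ ≤ Γ * q ^ 1 * (ν / (2 * (r : ℝ) + 6) * ((a : ℝ) * law)) :=
    mul_le_mul_of_nonneg_left hg₁ (by positivity)
  have hg₂2' : Γ * q ^ 2 * g₂ ≤ Γ * q ^ 2 * (ν * (ν - 2) / ((2 * (r : ℝ) + 6) * (2 * (r : ℝ) + 4)) * ((a : ℝ) ^ 2 * law)) :=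
    mul_le_mul_of_nonneg_left hg₂ (by positivity)
  have hg₂1' : Γ * q ^ 1 * g₂ ≤ Γ * q ^ 1 * (ν * (ν - 2) / ((2 * (r : ℝ) + 6) * (2 * (r : ℝ) + 4)) * ((a : ℝ) ^ 2 * law)) :=
    mul_le_mul_of_nonneg_left hg₂ (by positivity)
  have hg₂0' : Γ * q ^ 0 * g₂ ≤ Γ * q ^ 0 * (ν * (ν - 2) / ((2 * (r : ℝ) + 6) * (2 * (r : ℝ) + 4)) * ((a : ℝ) ^ 2 * law)) :=
    mul_le_mul_of_nonneg_left hg₂ (by positivity)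
  -- piece by piece
  have p1 : (2 * (r : ℝ) + 6) * ((2 * (r : ℝ) + 6) - 2) / (ν * (ν - 2)) * (Γ * q ^ 2 * g₂ + (a : ℝ) ^ 2 * W) ≤
      (2 * (r : ℝ) + 6) * ((2 * (r : ℝ) + 6) - 2) / (ν * (ν - 2)) *
        (Γ * q ^ 2 * (ν * (ν - 2) / ((2 * (r : ℝ) + 6) * (2 * (r : ℝ) + 4)) * ((a : ℝ) ^ 2 * law)) + (a : ℝ) ^ 2 * W) :=
    mul_le_mul_of_nonneg_left (by linarith) (div_nonneg (mul_nonneg hT0.le (by linarith)) hK0.le)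
  have p2 : 4 * (D : ℝ) * ((2 * (r : ℝ) + 6) - 2) / (ν * (ν - 2)) * (2 * (Γ * q ^ 1 * g₂ + (a : ℝ) ^ 2 * W)) ≤
      4 * (D : ℝ) * ((2 * (r : ℝ) + 6) - 2) / (ν * (ν - 2)) *
        (2 * (Γ * q ^ 1 * (ν * (ν - 2) / ((2 * (r : ℝ) + 6) * (2 * (r : ℝ) + 4)) * ((a : ℝ) ^ 2 * law)) + (a : ℝ) ^ 2 * W)) :=
    mul_le_mul_of_nonneg_left (by linarith) (div_nonneg (mul_nonneg (by positivity) (by linarith)) hK0.le)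
  have p3 : 8 * (D : ℝ) ^ 2 / (ν * (ν - 2)) * (4 * (Γ * q ^ 0 * g₂ + (a : ℝ) ^ 2 * W)) ≤
      8 * (D : ℝ) ^ 2 / (ν * (ν - 2)) *
        (4 * (Γ * q ^ 0 * (ν * (ν - 2) / ((2 * (r : ℝ) + 6) * (2 * (r : ℝ) + 4)) * ((a : ℝ) ^ 2 * law)) + (a : ℝ) ^ 2 * W)) :=
    mul_le_mul_of_nonneg_left (by linarith) (div_nonneg (by positivity) hK0.le)
  have p4 : |1 - 2 * m| * ((2 * (r : ℝ) + 6) / ν * (Γ * q ^ 2 * g₁ + (a : ℝ) * W) +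
          2 * (D : ℝ) / ν * (2 * (Γ * q ^ 1 * g₁ + (a : ℝ) * W))) ≤
      (2 * (a : ℝ) + 1) * ((2 * (r : ℝ) + 6) / ν * (Γ * q ^ 2 * (ν / (2 * (r : ℝ) + 6) * ((a : ℝ) * law)) + (a : ℝ) * W) +
          2 * (D : ℝ) / ν * (2 * (Γ * q ^ 1 * (ν / (2 * (r : ℝ) + 6) * ((a : ℝ) * law)) + (a : ℝ) * W))) := by
    have hin : (2 * (r : ℝ) + 6) / ν * (Γ * q ^ 2 * g₁ + (a : ℝ) * W) + 2 * (D : ℝ) / ν * (2 * (Γ * q ^ 1 * g₁ + (a : ℝ) * W)) ≤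
        (2 * (r : ℝ) + 6) / ν * (Γ * q ^ 2 * (ν / (2 * (r : ℝ) + 6) * ((a : ℝ) * law)) + (a : ℝ) * W) +
          2 * (D : ℝ) / ν * (2 * (Γ * q ^ 1 * (ν / (2 * (r : ℝ) + 6) * ((a : ℝ) * law)) + (a : ℝ) * W)) := by
      have q1 := mul_le_mul_of_nonneg_left (show Γ * q ^ 2 * g₁ + (a : ℝ) * W ≤
        Γ * q ^ 2 * (ν / (2 * (r : ℝ) + 6) * ((a : ℝ) * law)) + (a : ℝ) * W by linarith) (div_nonneg hT0.le hν0.le)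
      have q2 := mul_le_mul_of_nonneg_left (show 2 * (Γ * q ^ 1 * g₁ + (a : ℝ) * W) ≤
        2 * (Γ * q ^ 1 * (ν / (2 * (r : ℝ) + 6) * ((a : ℝ) * law)) + (a : ℝ) * W) by linarith)
        (div_nonneg (by positivity : (0 : ℝ) ≤ 2 * (D : ℝ)) hν0.le)
      linarith
    have hpos : 0 ≤ (2 * (r : ℝ) + 6) / ν * (Γ * q ^ 2 * (ν / (2 * (r : ℝ) + 6) * ((a : ℝ) * law)) + (a : ℝ) * W) +
          2 * (D : ℝ) / ν * (2 * (Γ * q ^ 1 * (ν / (2 * (r : ℝ) + 6) * ((a : ℝ) * law)) + (a : ℝ) * W)) := by positivity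
    calc _ ≤ |1 - 2 * m| * ((2 * (r : ℝ) + 6) / ν * (Γ * q ^ 2 * (ν / (2 * (r : ℝ) + 6) * ((a : ℝ) * law)) + (a : ℝ) * W) +
          2 * (D : ℝ) / ν * (2 * (Γ * q ^ 1 * (ν / (2 * (r : ℝ) + 6) * ((a : ℝ) * law)) + (a : ℝ) * W))) :=
          mul_le_mul_of_nonneg_left hin (abs_nonneg _)
      _ ≤ _ := mul_le_mul_of_nonneg_right habs1 hpos
  have p5 : m ^ 2 * (Γ * q ^ 2 * law + 1 * W) ≤ (a : ℝ) ^ 2 * (Γ * q ^ 2 * law + 1 * W) :=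
    mul_le_mul_of_nonneg_right hm2 (by positivity)
  -- the algebraic identity of the majorant
  have hid : (2 * (r : ℝ) + 6) * ((2 * (r : ℝ) + 6) - 2) / (ν * (ν - 2)) *
        (Γ * q ^ 2 * (ν * (ν - 2) / ((2 * (r : ℝ) + 6) * (2 * (r : ℝ) + 4)) * ((a : ℝ) ^ 2 * law)) + (a : ℝ) ^ 2 * W) +
      4 * (D : ℝ) * ((2 * (r : ℝ) + 6) - 2) / (ν * (ν - 2)) *
        (2 * (Γ * q ^ 1 * (ν * (ν - 2) / ((2 * (r : ℝ) + 6) * (2 * (r : ℝ) + 4)) * ((a : ℝ) ^ 2 * law)) + (a : ℝ) ^ 2 * W)) +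
      8 * (D : ℝ) ^ 2 / (ν * (ν - 2)) *
        (4 * (Γ * q ^ 0 * (ν * (ν - 2) / ((2 * (r : ℝ) + 6) * (2 * (r : ℝ) + 4)) * ((a : ℝ) ^ 2 * law)) + (a : ℝ) ^ 2 * W)) +
      (2 * (a : ℝ) + 1) * ((2 * (r : ℝ) + 6) / ν * (Γ * q ^ 2 * (ν / (2 * (r : ℝ) + 6) * ((a : ℝ) * law)) + (a : ℝ) * W) +
          2 * (D : ℝ) / ν * (2 * (Γ * q ^ 1 * (ν / (2 * (r : ℝ) + 6) * ((a : ℝ) * law)) + (a : ℝ) * W))) +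
      (a : ℝ) ^ 2 * (Γ * q ^ 2 * law + 1 * W) =
      (2 * Γ * q ^ 2 * (a : ℝ) ^ 2 + 8 * (D : ℝ) * Γ * q * (a : ℝ) ^ 2 / (2 * (r : ℝ) + 6) +
            32 * (D : ℝ) ^ 2 * Γ * (a : ℝ) ^ 2 / ((2 * (r : ℝ) + 6) * (2 * (r : ℝ) + 4)) +
            (2 * (a : ℝ) + 1) * a * (Γ * q ^ 2 + 4 * (D : ℝ) * Γ * q / (2 * (r : ℝ) + 6))) * law +
        (4 / 3 : ℝ) ^ 0 * 0 +
        ((a : ℝ) ^ 2 * ((2 * (r : ℝ) + 6) * (2 * (r : ℝ) + 4) / (ν * (ν - 2)) + 8 * (D : ℝ) * (2 * (r : ℝ) + 4) / (ν * (ν - 2)) +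
                32 * (D : ℝ) ^ 2 / (ν * (ν - 2)) + 1) +
              (2 * (a : ℝ) + 1) * a * ((2 * (r : ℝ) + 6 + 4 * D) / ν)) * W := by
    have h1 : ν ≠ 0 := hν0.ne'
    have h2 : ν - 2 ≠ 0 := by
      have : 0 < ν - 2 := by linarith
      exact this.ne'
    have h3 : 2 * (r : ℝ) + 6 ≠ 0 := hT0.ne'
    have h4 : 2 * (r : ℝ) + 4 ≠ 0 := hT4.ne'
    field_simp
    ring
  have hsum : (2 * (r : ℝ) + 6) * ((2 * (r : ℝ) + 6) - 2) / (ν * (ν - 2)) * (Γ * q ^ 2 * g₂ + (a : ℝ) ^ 2 * W) +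
          4 * (D : ℝ) * ((2 * (r : ℝ) + 6) - 2) / (ν * (ν - 2)) * (2 * (Γ * q ^ 1 * g₂ + (a : ℝ) ^ 2 * W)) +
          8 * (D : ℝ) ^ 2 / (ν * (ν - 2)) * (4 * (Γ * q ^ 0 * g₂ + (a : ℝ) ^ 2 * W)) +
        |1 - 2 * m| * ((2 * (r : ℝ) + 6) / ν * (Γ * q ^ 2 * g₁ + (a : ℝ) * W) +
          2 * (D : ℝ) / ν * (2 * (Γ * q ^ 1 * g₁ + (a : ℝ) * W))) +
        m ^ 2 * (Γ * q ^ 2 * law + 1 * W) ≤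
      (2 * Γ * q ^ 2 * (a : ℝ) ^ 2 + 8 * (D : ℝ) * Γ * q * (a : ℝ) ^ 2 / (2 * (r : ℝ) + 6) +
            32 * (D : ℝ) ^ 2 * Γ * (a : ℝ) ^ 2 / ((2 * (r : ℝ) + 6) * (2 * (r : ℝ) + 4)) +
            (2 * (a : ℝ) + 1) * a * (Γ * q ^ 2 + 4 * (D : ℝ) * Γ * q / (2 * (r : ℝ) + 6))) * law +
        ((a : ℝ) ^ 2 * ((2 * (r : ℝ) + 6) * (2 * (r : ℝ) + 4) / (ν * (ν - 2)) + 8 * (D : ℝ) * (2 * (r : ℝ) + 4) / (ν * (ν - 2)) +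
                32 * (D : ℝ) ^ 2 / (ν * (ν - 2)) + 1) +
              (2 * (a : ℝ) + 1) * a * ((2 * (r : ℝ) + 6 + 4 * D) / ν)) * W := by
    have h := add_le_add (add_le_add (add_le_add (add_le_add p1 p2) p3) p4) p5
    rw [hid] at h
    simpa using h
  have hfinal := mul_le_mul_of_nonneg_left hsum hD0
  rw [hW] at hfinal ⊢
  refine hfinal.trans (le_of_eq ?_)
  ring

end Summit.PneNP.PneNP.Theorems.ChebyshevTracialDesignGammaDirectionSecondMomentRelativeOrders

end
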